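import Literature.ModelTheory.ExponentialFields.Wilkie1996
import Literature.ModelTheory.ExponentialFields.Wilkie1989Lemma3Proofs
import HarnessLib

/-!
# Wilkie 1996/1989: unravelling nested exponentials (proved), and the assembly of Wilkie's theorem from its two printed leaves

Trunk `TranscendEllArithS`, family `periods` (periods.S28): discharge of the named fact
`Literature.ModelTheory.ExponentialFields.Wilkie1996_unravelling` of `Wilkie1996.lean`, the syntactic bridge between

* the exponential-algebraic points of A. J. Wilkie, *On the theory of the real exponential field*,
  Illinois J. Math. 33 (1989), p. 386 — non-singular zeros `ᾱ ∈ Kⁿ` of square systems of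
  arbitrary exponential *terms* `F₁, …, Fₙ ∈ k[x̄]ᵉ` (`RealExpModel.IsExpAlgebraicPointOver`,
  `Wilkie1989.lean`), the notion in the hypothesis of his Theorem 2
  (`Literature.ModelTheory.ExponentialFields.Wilkie1989_existentiallyClosed_of_bounded`), and
* the definable points of A. J. Wilkie, *Model completeness results for expansions of the ordered
  field of real numbers by restricted Pfaffian functions and the exponential function*, J. Amer.
  Math. Soc. 9 (1996), Definition 2.5 and §9, p. 1083 — non-singular zeros of square systems of
  exponential *polynomials* `f₁, …, fₙ ∈ k[x̄, e^{x̄}]` (`RealExpModel.IsExpPolynomialPointOver`,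
  `Wilkie1996.lean`), the notion in Theorem 7.2 and in the boundedness statement proved in
  §§9–11 (`Literature.ModelTheory.ExponentialFields.Wilkie1996_expPolynomialPoints_bounded`),

implicit in Wilkie's remarks "composite terms may be unravelled at the expense of introducing
extra existentially quantified variables" (1996, p. 1056) and "(This reduction … was already
established in [16] (Theorem 2))" (1996, p. 1083).

**Theorem** (`Literature.ModelTheory.ExponentialFields.Wilkie1996_unravelling_holds`).  For models `f : k ↪ K` of `T_exp`, every
exponential-algebraic point `ᾱ ∈ Kⁿ` over `k` extends to a non-singular zero `(ᾱ, β̄) ∈ Kⁿ⁺ᵐ` of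
a square exponential-polynomial system over `k`.

*Proof (formalised here).*  Induction on the number `N = Σᵢ nvCount Fᵢ` of subterms `exp(t)` of
the system with `t` not an unknown `xⱼ` (`RealExpModel.nvCount`).  If `N = 0` every `Fᵢ` is,
syntactically, an exponential polynomial (`RealExpModel.expPolyTerm_toPoly`).  If `N > 0`, pick
an innermost such `exp(t₀)` (`RealExpModel.exists_innermost`) and pass to the system in the
unknowns `x̄, z, y` consisting of the `Fᵢ` with every occurrence of `exp(t₀)` replaced by `y`,
and the equations `z - t₀ = 0`, `y - exp(z) = 0` (`RealExpModel.unravelSys`), at the point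
`(ᾱ, t₀(ᾱ), e^{t₀(ᾱ)})` (`RealExpModel.unravelPt`).  Values are unchanged
(`RealExpModel.realize_unravelStep`), the chain rule
`∂Fᵢ/∂xⱼ = ∂Fᵢ'/∂xⱼ + ∂Fᵢ'/∂y · e^{t₀} ∂t₀/∂xⱼ` holds for the formal derivatives
(`RealExpModel.realize_termPDeriv_unravelStep`), so the new Jacobian matrix is
`[[A', 0, c], [-∇t₀, 1, 0], [0, -e^{t₀}, 1]]` with `A' + e^{t₀} c ∇t₀ᵀ` the old one
(`RealExpModel.jacobian_unravelSys_submatrix`) and the determinant is unchanged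
(`RealExpModel.det_fromBlocks_unravel`, `RealExpModel.det_jacobian_unravelSys`); and `N` drops
(`RealExpModel.sum_nvCount_unravelSys_lt`).

Consequences (proved): the term form and the exponential-polynomial form of the boundedness
statement are equivalent (`Literature.ModelTheory.ExponentialFields.Wilkie1996_expAlgebraicPoints_bounded_iff`); Theorem 7.2 in the
exponential case follows from Wilkie 1989, Theorem 2 (`Literature.ModelTheory.ExponentialFields.Wilkie1996_thm7_2_exp_of_thm2'`) and
hence from the statement of Wilkie 1989, §5 alone (`Literature.ModelTheory.ExponentialFields.Wilkie1996_thm7_2_exp_of_mem`, Lemma 3 and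
Corollary 1 being proved in `Wilkie1989Lemma3Proofs.lean`); and **Wilkie's theorem
`Literature.ModelTheory.ExponentialFields.wilkie_isModelComplete` follows from exactly two named facts, both printed statements**:
`Literature.ModelTheory.ExponentialFields.Wilkie1989_expAlgebraicPoints_mem` (Wilkie 1989, §5, p. 399: bounded e.a. points over `k` lie in
`kⁿ`; §§5–6 of that paper) and `Literature.ModelTheory.ExponentialFields.Wilkie1996_expPolynomialPoints_bounded` (Wilkie 1996, §9,
p. 1083; §§9–11 of that paper) — `Literature.ModelTheory.ExponentialFields.wilkie_isModelComplete_of_mem_of_expPolynomialPoints_bounded`.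

## Design choices

* One exponential at a time, all occurrences of the chosen `exp(t₀)` at once
  (`RealExpModel.unravelStep`, a structural recursion comparing subterms with `exp(t₀)`;
  classical decidability of equality of terms).  "Innermost" means: `t₀` is not an unknown and
  contains no `exp` of a non-unknown, so that `z - t₀` and `y - exp(z)` are exponential
  polynomials; exponentials of parameters `exp(c)`, `c ∈ k`, are unravelled too (they are not
  of the form `p(x̄, e^{x̄})` syntactically).
* Why not the flattening `RealExpModel.flat` / `expArgs` / `cstr` / `master` of
  `ExistentialReduction.lean` (`RealExpModel.exists_expPoly_iff`)?  That construction works at the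
  level of *solvability*: it names every exponentiated subterm at once and aggregates all the
  resulting equations into a single sum of squares `master t = 0`, whose zeros are all singular
  (the gradient of a sum of squares vanishes on its zero set); it cannot transport the Jacobian
  condition `J(F₁, …, Fₙ)(ᾱ) ≠ 0`.  Here the system stays square and the determinant is tracked
  exactly, one exponential at a time.
* The new unknowns are appended (`Fin (n + 2)`, `Fin.castAdd 2` for the old ones, `zIdx`,
  `yIdx`); the induction produces a point of `Kᵐ` extending `ᾱ` along `Fin.castLE`, repackaged
  as `Fin.append ᾱ β̄` at the end.
* Everything is stated for bundled models `K : Theory.ModelType.{0, 0, 0} realExpTheory` and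
  parameter valuations `a : κ → K` (used with `a = f`), as in `Wilkie1989.lean`.

## References

* A. J. Wilkie, *Model completeness results for expansions of the ordered field of real numbers
  by restricted Pfaffian functions and the exponential function*, J. Amer. Math. Soc. 9 (1996),
  1051–1094: p. 1056, Definition 2.5 (pp. 1058–1059), Theorem 7.2 (p. 1078), §9 (p. 1083).
* A. J. Wilkie, *On the theory of the real exponential field*, Illinois J. Math. 33 (1989),
  384–408: §1 (p. 386), Theorem 2, §5 (p. 399).
-/

noncomputable section

open FirstOrder FirstOrder.Language FirstOrder.Language.Structure
open scoped Classical

namespace Literature.ModelTheory.ExponentialFields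

namespace RealExpModel

/-! ### Syntax: counting exponentials of non-variables, occurrences, one unravelling step -/

section Syntax

variable {κ ι : Type} {n : ℕ}

/-- `1` unless the term is an unknown `xᵢ` (then `0`): the contribution of `exp(t)` to the count of
exponentials applied to non-unknowns. [folklore] -/
def expPenalty : Language.orderedExpRing.Term (κ ⊕ ι) → ℕ
  | var (Sum.inr _) => 0
  | _ => 1

/-- The number of subterms `exp(t)` of a term with `t` not an unknown `xᵢ`. [folklore] -/
def nvCount : Language.orderedExpRing.Term (κ ⊕ ι) → ℕ
  | var _ => 0
  | func expRingFunc.add ts => (fun l => nvCount (ts l)) 0 + (fun l => nvCount (ts l)) 1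
  | func expRingFunc.mul ts => (fun l => nvCount (ts l)) 0 + (fun l => nvCount (ts l)) 1
  | func expRingFunc.neg ts => (fun l => nvCount (ts l)) 0
  | func expRingFunc.zero _ => 0
  | func expRingFunc.one _ => 0
  | func expRingFunc.exp ts => expPenalty (ts 0) + (fun l => nvCount (ts l)) 0

/-- The number of occurrences of the subterm `exp(t₀)` in a term (occurrences inside an
occurrence are not counted). [folklore] -/
def occ (t₀ : Language.orderedExpRing.Term (κ ⊕ ι)) : Language.orderedExpRing.Term (κ ⊕ ι) → ℕ
  | var _ => 0
  | func expRingFunc.add ts => (fun l => occ t₀ (ts l)) 0 + (fun l => occ t₀ (ts l)) 1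
  | func expRingFunc.mul ts => (fun l => occ t₀ (ts l)) 0 + (fun l => occ t₀ (ts l)) 1
  | func expRingFunc.neg ts => (fun l => occ t₀ (ts l)) 0
  | func expRingFunc.zero _ => 0
  | func expRingFunc.one _ => 0
  | func expRingFunc.exp ts =>
    if func expRingFunc.exp ts = Language.orderedExpRing.termExp t₀ then 1
    else (fun l => occ t₀ (ts l)) 0

/-- The index of the new unknown `z` (value of `t₀`) among `x₁, …, xₙ, z, y`. [folklore] -/
def zIdx (n : ℕ) : Fin (n + 2) := Fin.natAdd n 0

/-- The index of the new unknown `y` (value of `exp(t₀)`) among `x₁, …, xₙ, z, y`. [folklore] -/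
def yIdx (n : ℕ) : Fin (n + 2) := Fin.natAdd n 1

/-- The old unknowns among `x₁, …, xₙ, z, y`. [folklore] -/
def liftTerm₂ (t : Language.orderedExpRing.Term (κ ⊕ Fin n)) :
    Language.orderedExpRing.Term (κ ⊕ Fin (n + 2)) :=
  t.relabel (Sum.map _root_.id (Fin.castAdd 2))

/-- **One unravelling step**: replace every occurrence of `exp(t₀)` by the new unknown `y` (and
rename the old unknowns into `x₁, …, xₙ, z, y`). [folklore] -/
def unravelStep (t₀ : Language.orderedExpRing.Term (κ ⊕ Fin n)) :
    Language.orderedExpRing.Term (κ ⊕ Fin n) → Language.orderedExpRing.Term (κ ⊕ Fin (n + 2))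
  | var v => var (Sum.map _root_.id (Fin.castAdd 2) v)
  | func expRingFunc.add ts => (fun l => unravelStep t₀ (ts l)) 0 + (fun l => unravelStep t₀ (ts l)) 1
  | func expRingFunc.mul ts => (fun l => unravelStep t₀ (ts l)) 0 * (fun l => unravelStep t₀ (ts l)) 1
  | func expRingFunc.neg ts => -(fun l => unravelStep t₀ (ts l)) 0
  | func expRingFunc.zero _ => 0
  | func expRingFunc.one _ => 1
  | func expRingFunc.exp ts =>
    if func expRingFunc.exp ts = Language.orderedExpRing.termExp t₀ then var (Sum.inr (yIdx n))
    else Language.orderedExpRing.termExp ((fun l => unravelStep t₀ (ts l)) 0)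

/-- The unravelled system in the unknowns `x₁, …, xₙ, z, y`: the old equations with `exp(t₀)`
replaced by `y`, and the two new equations `z - t₀ = 0`, `y - exp(z) = 0`. [folklore] -/
def unravelSys (t₀ : Language.orderedExpRing.Term (κ ⊕ Fin n))
    (F : Fin n → Language.orderedExpRing.Term (κ ⊕ Fin n)) :
    Fin (n + 2) → Language.orderedExpRing.Term (κ ⊕ Fin (n + 2)) :=
  Fin.append (fun i => unravelStep t₀ (F i))
    ![var (Sum.inr (zIdx n)) + -liftTerm₂ t₀,
      var (Sum.inr (yIdx n)) + -Language.orderedExpRing.termExp (var (Sum.inr (zIdx n)))]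

/-- The new unknowns `z` and `y` are distinct. [folklore] -/
theorem zIdx_ne_yIdx : zIdx n ≠ yIdx n := by
  simp [zIdx, yIdx, Fin.ext_iff]

/-- An old unknown is not `z`. [folklore] -/
theorem castAdd_ne_zIdx (j : Fin n) : Fin.castAdd 2 j ≠ zIdx n := by
  intro h
  have := congrArg Fin.val h
  simp [zIdx] at this
  omega

/-- An old unknown is not `y`. [folklore] -/
theorem castAdd_ne_yIdx (j : Fin n) : Fin.castAdd 2 j ≠ yIdx n := by
  intro h
  have := congrArg Fin.val h
  simp [yIdx] at this
  omega

/-- The unravelling step on a variable (by `rfl`). [folklore] -/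
@[simp] theorem unravelStep_var (t₀ : Language.orderedExpRing.Term (κ ⊕ Fin n)) (v : κ ⊕ Fin n) :
    unravelStep t₀ (var v) = var (Sum.map _root_.id (Fin.castAdd 2) v) := rfl

/-- The unravelling step commutes with `+` (by `rfl`). [folklore] -/
@[simp] theorem unravelStep_add (t₀ a b : Language.orderedExpRing.Term (κ ⊕ Fin n)) :
    unravelStep t₀ (a + b) = unravelStep t₀ a + unravelStep t₀ b := rfl

/-- The unravelling step commutes with `*` (by `rfl`). [folklore] -/
@[simp] theorem unravelStep_mul (t₀ a b : Language.orderedExpRing.Term (κ ⊕ Fin n)) :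
    unravelStep t₀ (a * b) = unravelStep t₀ a * unravelStep t₀ b := rfl

/-- The unravelling step commutes with `-` (by `rfl`). [folklore] -/
@[simp] theorem unravelStep_neg (t₀ a : Language.orderedExpRing.Term (κ ⊕ Fin n)) :
    unravelStep t₀ (-a) = -unravelStep t₀ a := rfl

/-- The unravelling step fixes `0` (by `rfl`). [folklore] -/
@[simp] theorem unravelStep_zero (t₀ : Language.orderedExpRing.Term (κ ⊕ Fin n)) :
    unravelStep t₀ (0 : Language.orderedExpRing.Term (κ ⊕ Fin n)) = 0 := rfl

/-- The unravelling step fixes `1` (by `rfl`). [folklore] -/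
@[simp] theorem unravelStep_one (t₀ : Language.orderedExpRing.Term (κ ⊕ Fin n)) :
    unravelStep t₀ (1 : Language.orderedExpRing.Term (κ ⊕ Fin n)) = 1 := rfl

/-- The unravelling step on `exp(a)`: the new unknown `y` if `exp(a)` is `exp(t₀)`, else `exp` of the
unravelled argument (by `rfl`). [folklore] -/
theorem unravelStep_termExp (t₀ a : Language.orderedExpRing.Term (κ ⊕ Fin n)) :
    unravelStep t₀ (Language.orderedExpRing.termExp a) =
      if Language.orderedExpRing.termExp a = Language.orderedExpRing.termExp t₀ then
        var (Sum.inr (yIdx n))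
      else Language.orderedExpRing.termExp (unravelStep t₀ a) := rfl

/-- `nvCount` of a sum (by `rfl`). [folklore] -/
@[simp] theorem nvCount_add (a b : Language.orderedExpRing.Term (κ ⊕ ι)) :
    nvCount (a + b) = nvCount a + nvCount b := rfl
/-- `nvCount` of a product (by `rfl`). [folklore] -/
@[simp] theorem nvCount_mul (a b : Language.orderedExpRing.Term (κ ⊕ ι)) :
    nvCount (a * b) = nvCount a + nvCount b := rfl
/-- `nvCount` of a negation (by `rfl`). [folklore] -/
@[simp] theorem nvCount_neg (a : Language.orderedExpRing.Term (κ ⊕ ι)) :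
    nvCount (-a) = nvCount a := rfl
/-- `nvCount 0 = 0` (by `rfl`). [folklore] -/
@[simp] theorem nvCount_zero : nvCount (0 : Language.orderedExpRing.Term (κ ⊕ ι)) = 0 := rfl
/-- `nvCount 1 = 0` (by `rfl`). [folklore] -/
@[simp] theorem nvCount_one : nvCount (1 : Language.orderedExpRing.Term (κ ⊕ ι)) = 0 := rfl
/-- Variables have no exponentials (by `rfl`). [folklore] -/
@[simp] theorem nvCount_var (v : κ ⊕ ι) : nvCount (var v : Language.orderedExpRing.Term (κ ⊕ ι)) = 0 := rfl
/-- `nvCount` of `exp(a)` (by `rfl`). [folklore] -/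
@[simp] theorem nvCount_termExp (a : Language.orderedExpRing.Term (κ ⊕ ι)) :
    nvCount (Language.orderedExpRing.termExp a) = expPenalty a + nvCount a := rfl

/-- Occurrences in a sum (by `rfl`). [folklore] -/
@[simp] theorem occ_add (t₀ a b : Language.orderedExpRing.Term (κ ⊕ ι)) :
    occ t₀ (a + b) = occ t₀ a + occ t₀ b := rfl
/-- Occurrences in a product (by `rfl`). [folklore] -/
@[simp] theorem occ_mul (t₀ a b : Language.orderedExpRing.Term (κ ⊕ ι)) :
    occ t₀ (a * b) = occ t₀ a + occ t₀ b := rfl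
/-- Occurrences in a negation (by `rfl`). [folklore] -/
@[simp] theorem occ_neg (t₀ a : Language.orderedExpRing.Term (κ ⊕ ι)) :
    occ t₀ (-a) = occ t₀ a := rfl
/-- No occurrences in `0` (by `rfl`). [folklore] -/
@[simp] theorem occ_zero (t₀ : Language.orderedExpRing.Term (κ ⊕ ι)) :
    occ t₀ (0 : Language.orderedExpRing.Term (κ ⊕ ι)) = 0 := rfl
/-- No occurrences in `1` (by `rfl`). [folklore] -/
@[simp] theorem occ_one (t₀ : Language.orderedExpRing.Term (κ ⊕ ι)) :
    occ t₀ (1 : Language.orderedExpRing.Term (κ ⊕ ι)) = 0 := rfl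
/-- No occurrences in a variable (by `rfl`). [folklore] -/
@[simp] theorem occ_var (t₀ : Language.orderedExpRing.Term (κ ⊕ ι)) (v : κ ⊕ ι) :
    occ t₀ (var v) = 0 := rfl
/-- Occurrences in `exp(a)` (by `rfl`). [folklore] -/
theorem occ_termExp (t₀ a : Language.orderedExpRing.Term (κ ⊕ ι)) :
    occ t₀ (Language.orderedExpRing.termExp a) =
      if Language.orderedExpRing.termExp a = Language.orderedExpRing.termExp t₀ then 1
      else occ t₀ a := rfl

/-- An unknown has penalty `0` (by `rfl`). [folklore] -/
@[simp] theorem expPenalty_var_inr (i : ι) :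
    expPenalty (var (Sum.inr i) : Language.orderedExpRing.Term (κ ⊕ ι)) = 0 := rfl
/-- A parameter has penalty `1` (by `rfl`). [folklore] -/
@[simp] theorem expPenalty_var_inl (c : κ) :
    expPenalty (var (Sum.inl c) : Language.orderedExpRing.Term (κ ⊕ ι)) = 1 := rfl
/-- A composite term has penalty `1` (by `rfl`). [folklore] -/
@[simp] theorem expPenalty_func {l : ℕ} (g : Language.orderedExpRing.Functions l)
    (ts : Fin l → Language.orderedExpRing.Term (κ ⊕ ι)) : expPenalty (func g ts) = 1 := rfl

/-- The penalty is at most `1`. [folklore] -/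
theorem expPenalty_le_one (t : Language.orderedExpRing.Term (κ ⊕ ι)) : expPenalty t ≤ 1 := by
  rcases t with (c | i) | ⟨g, ts⟩ <;> simp [expPenalty]

end Syntax

/-! ### Semantics of one unravelling step in a model of `T_exp` -/

section Semantics

variable {K : Language.Theory.ModelType.{0, 0, 0} realExpTheory} {κ : Type} {n : ℕ}

/-- The extended point `(ᾱ, t₀(ᾱ), e^{t₀(ᾱ)})`. [folklore] -/
def unravelPt (a : κ → K) (α : Fin n → K) (t₀ : Language.orderedExpRing.Term (κ ⊕ Fin n)) :
    Fin (n + 2) → K :=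
  Fin.append α ![t₀.realize (Sum.elim a α), exp (t₀.realize (Sum.elim a α))]

variable (a : κ → K) (α : Fin n → K) (t₀ : Language.orderedExpRing.Term (κ ⊕ Fin n))

/-- The old coordinates of the extended point. [folklore] -/
@[simp] theorem unravelPt_castAdd (j : Fin n) : unravelPt a α t₀ (Fin.castAdd 2 j) = α j := by
  simp [unravelPt]

/-- The `z`-coordinate of the extended point is `t₀(ᾱ)`. [folklore] -/
@[simp] theorem unravelPt_zIdx : unravelPt a α t₀ (zIdx n) = t₀.realize (Sum.elim a α) := by
  simp [unravelPt, zIdx]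

/-- The `y`-coordinate of the extended point is `e^{t₀(ᾱ)}`. [folklore] -/
@[simp] theorem unravelPt_yIdx : unravelPt a α t₀ (yIdx n) = exp (t₀.realize (Sum.elim a α)) := by
  simp [unravelPt, yIdx]

/-- Restricting the extended valuation to the old variables gives the old valuation. [folklore] -/
theorem elim_unravelPt_comp_map :
    Sum.elim a (unravelPt a α t₀) ∘ Sum.map _root_.id (Fin.castAdd 2) = Sum.elim a α := by
  funext v
  rcases v with c | j <;> simp

/-- A lifted term takes its old value at the extended point. [folklore] -/
@[simp] theorem realize_liftTerm₂ (t : Language.orderedExpRing.Term (κ ⊕ Fin n)) :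
    (liftTerm₂ t).realize (Sum.elim a (unravelPt a α t₀)) = t.realize (Sum.elim a α) := by
  rw [liftTerm₂, Term.realize_relabel, elim_unravelPt_comp_map]

/-- **The unravelling step does not change values**: at the extended point, the unravelled term
takes the value of the original term at `ᾱ`. [folklore] -/
@[simp] theorem realize_unravelStep (s : Language.orderedExpRing.Term (κ ⊕ Fin n)) :
    (unravelStep t₀ s).realize (Sum.elim a (unravelPt a α t₀)) = s.realize (Sum.elim a α) := by
  induction s with
  | var v =>
    rcases v with c | j <;> simp
  | func g ts ih =>
    cases g with
    | add => simp [unravelStep, ih]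
    | mul => simp [unravelStep, ih]
    | neg => simp [unravelStep, ih]
    | zero => simp [unravelStep]
    | one => simp [unravelStep]
    | exp =>
      by_cases h : func expRingFunc.exp ts = Language.orderedExpRing.termExp t₀
      · simp only [unravelStep, h, if_true, Term.realize_var, Sum.elim_inr, unravelPt_yIdx]
        rw [realize_termExp]
      · simp only [unravelStep, h, if_false, realize_termExp, ih, Term.realize_func, funMap_exp]

/-- The unravelled terms do not involve the unknown `z`: `∂/∂z` vanishes on them (semantically,
at every valuation). [folklore] -/
theorem realize_termPDeriv_zIdx_unravelStep (w : κ ⊕ Fin (n + 2) → K)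
    (s : Language.orderedExpRing.Term (κ ⊕ Fin n)) :
    (termPDeriv (zIdx n) (unravelStep t₀ s)).realize w = 0 := by
  induction s with
  | var v =>
    rcases v with c | j
    · simp
    · simp [termPDeriv, castAdd_ne_zIdx]
  | func g ts ih =>
    cases g with
    | add => simp [unravelStep, ih]
    | mul => simp [unravelStep, ih]
    | neg => simp [unravelStep, ih]
    | zero => simp [unravelStep]
    | one => simp [unravelStep]
    | exp =>
      by_cases h : func expRingFunc.exp ts = Language.orderedExpRing.termExp t₀
      · simp [unravelStep, h, termPDeriv, (zIdx_ne_yIdx (n := n)).symm]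
      · simp [unravelStep, h, ih]

/-- **Chain rule for the unravelling step.**  With `C = e^{t₀(ᾱ)} · ∂t₀/∂xⱼ(ᾱ)`:
`∂s/∂xⱼ(ᾱ) = ∂s'/∂xⱼ(ᾱ') + ∂s'/∂y(ᾱ') · C`, where `s'` is the unravelled term and `ᾱ'` the
extended point (`s = s'[y := exp(t₀)]`). [folklore] -/
theorem realize_termPDeriv_unravelStep (s : Language.orderedExpRing.Term (κ ⊕ Fin n)) (j : Fin n) :
    (termPDeriv j s).realize (Sum.elim a α) =
      (termPDeriv (Fin.castAdd 2 j) (unravelStep t₀ s)).realize (Sum.elim a (unravelPt a α t₀)) +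
        (termPDeriv (yIdx n) (unravelStep t₀ s)).realize (Sum.elim a (unravelPt a α t₀)) *
          (exp (t₀.realize (Sum.elim a α)) * (termPDeriv j t₀).realize (Sum.elim a α)) := by
  induction s with
  | var v =>
    rcases v with c | i
    · simp [termPDeriv]
    · by_cases hij : i = j
      · subst hij
        simp [termPDeriv, castAdd_ne_yIdx]
      · have h1 : Fin.castAdd 2 i ≠ Fin.castAdd 2 j := fun h => hij (Fin.castAdd_injective _ _ h)
        simp [termPDeriv, hij, h1, castAdd_ne_yIdx]
  | func g ts ih =>
    cases g with
    | add =>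
      simp only [termPDeriv, unravelStep, termPDeriv_add, realize_add, ih]
      ring
    | mul =>
      simp only [termPDeriv, unravelStep, termPDeriv_mul, realize_add, realize_mul,
        realize_unravelStep, ih]
      ring
    | neg =>
      simp only [termPDeriv, unravelStep, termPDeriv_neg, realize_neg, ih]
      ring
    | zero => simp [termPDeriv, unravelStep]
    | one => simp [termPDeriv, unravelStep]
    | exp =>
      by_cases h : func expRingFunc.exp ts = Language.orderedExpRing.termExp t₀
      · rw [h, unravelStep_termExp, if_pos rfl]
        simp [termPDeriv, (castAdd_ne_yIdx (n := n) j).symm]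
      · simp only [termPDeriv, unravelStep, h, if_false, termPDeriv_termExp, realize_mul,
          realize_termExp, realize_unravelStep, ih]
        ring

end Semantics

/-! ### The Jacobian of the unravelled system -/

section LinearAlgebra

variable {R : Type*} [CommRing R] {n : ℕ}

/-- The block determinant identity behind one unravelling step:
`det [[A', 0, c], [-u, 1, 0], [0, -E, 1]] = det (A' + E c uᵀ)` (two column operations). [folklore] -/
theorem det_fromBlocks_unravel (A' : Matrix (Fin n) (Fin n) R) (c u : Fin n → R) (E : R) :
    (Matrix.fromBlocks A' (Matrix.of fun i (b : Fin 2) => ![0, c i] b)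
        (Matrix.of fun (b : Fin 2) j => ![-u j, 0] b) !![1, 0; -E, 1]).det =
      (A' + Matrix.of fun i j => c i * (E * u j)).det := by
  set A : Matrix (Fin n) (Fin n) R := A' + Matrix.of fun i j => c i * (E * u j) with hA
  set P : Matrix (Fin n) (Fin 2) R := Matrix.of fun i (b : Fin 2) => ![c i * E, c i] b with hP
  have hfact : Matrix.fromBlocks A' (Matrix.of fun i (b : Fin 2) => ![0, c i] b)
      (Matrix.of fun (b : Fin 2) j => ![-u j, 0] b) !![1, 0; -E, 1] =
      Matrix.fromBlocks 1 P 0 1 *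
        Matrix.fromBlocks A 0 (Matrix.of fun (b : Fin 2) j => ![-u j, 0] b) !![1, 0; -E, 1] := by
    rw [Matrix.fromBlocks_multiply]
    simp only [Matrix.one_mul, Matrix.zero_mul, Matrix.mul_zero, zero_add]
    ext (i | b) (j | b')
    · simp [Matrix.mul_apply, Fin.sum_univ_two, hA, hP]
      ring
    · fin_cases b'
      · simp [Matrix.mul_apply, Fin.sum_univ_two, hP]
      · simp [Matrix.mul_apply, Fin.sum_univ_two, hP]
    · rfl
    · rfl
  rw [hfact, Matrix.det_mul, Matrix.det_fromBlocks_zero₂₁, Matrix.det_fromBlocks_zero₁₂,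
    Matrix.det_one, Matrix.det_one, Matrix.det_fin_two_of]
  ring

end LinearAlgebra

section Jacobian

variable {K : Language.Theory.ModelType.{0, 0, 0} realExpTheory} {κ : Type} {n : ℕ}
variable (a : κ → K) (α : Fin n → K) (t₀ : Language.orderedExpRing.Term (κ ⊕ Fin n))
  (F : Fin n → Language.orderedExpRing.Term (κ ⊕ Fin n))

/-- `Fin.natAdd n 0` is the index `z` (by `rfl`). [folklore] -/
@[simp] theorem natAdd_zero_eq_zIdx : Fin.natAdd n (0 : Fin 2) = zIdx n := rfl

/-- `Fin.natAdd n 1` is the index `y` (by `rfl`). [folklore] -/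
@[simp] theorem natAdd_one_eq_yIdx : Fin.natAdd n (1 : Fin 2) = yIdx n := rfl

/-- `z` is not an old unknown. [folklore] -/
theorem zIdx_not_mem_range : zIdx n ∉ Set.range (Fin.castAdd 2 : Fin n → Fin (n + 2)) := by
  rintro ⟨j, hj⟩
  exact castAdd_ne_zIdx j hj

/-- `y` is not an old unknown. [folklore] -/
theorem yIdx_not_mem_range : yIdx n ∉ Set.range (Fin.castAdd 2 : Fin n → Fin (n + 2)) := by
  rintro ⟨j, hj⟩
  exact castAdd_ne_yIdx j hj

/-- The old equations of the unravelled system. [folklore] -/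
@[simp] theorem unravelSys_castAdd (i : Fin n) :
    unravelSys t₀ F (Fin.castAdd 2 i) = unravelStep t₀ (F i) := by
  simp [unravelSys]

/-- The equation `z - t₀ = 0` of the unravelled system. [folklore] -/
@[simp] theorem unravelSys_zIdx :
    unravelSys t₀ F (zIdx n) = var (Sum.inr (zIdx n)) + -liftTerm₂ t₀ := by
  rw [← natAdd_zero_eq_zIdx, unravelSys, Fin.append_right]
  rfl

/-- The equation `y - exp(z) = 0` of the unravelled system. [folklore] -/
@[simp] theorem unravelSys_yIdx :
    unravelSys t₀ F (yIdx n) =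
      var (Sum.inr (yIdx n)) + -Language.orderedExpRing.termExp (var (Sum.inr (zIdx n))) := by
  rw [← natAdd_one_eq_yIdx, unravelSys, Fin.append_right]
  rfl

/-- The Jacobian matrix of the unravelled system at the extended point, in block form on
`Fin n ⊕ Fin 2`: `[[A', 0, c], [-∇t₀, 1, 0], [0, -e^{t₀}, 1]]`. [folklore] -/
theorem jacobian_unravelSys_submatrix :
    (jacobian (unravelSys t₀ F) a (unravelPt a α t₀)).submatrix finSumFinEquiv finSumFinEquiv =
      Matrix.fromBlocks
        (Matrix.of fun i j =>
          (termPDeriv (Fin.castAdd 2 j) (unravelStep t₀ (F i))).realize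
            (Sum.elim a (unravelPt a α t₀)))
        (Matrix.of fun i (b : Fin 2) =>
          ![0, (termPDeriv (yIdx n) (unravelStep t₀ (F i))).realize
            (Sum.elim a (unravelPt a α t₀))] b)
        (Matrix.of fun (b : Fin 2) j => ![-(termPDeriv j t₀).realize (Sum.elim a α), 0] b)
        !![1, 0; -exp (t₀.realize (Sum.elim a α)), 1] := by
  ext (i | b) (j | b')
  · simp [jacobian]
  · fin_cases b'
    · simp [jacobian, realize_termPDeriv_zIdx_unravelStep]
    · simp [jacobian]
  · fin_cases b
    · simp [jacobian, termPDeriv, liftTerm₂, (castAdd_ne_zIdx (n := n) j).symm,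
        realize_termPDeriv_relabel_of_injective (Fin.castAdd_injective n 2),
        elim_unravelPt_comp_map]
    · simp [jacobian, termPDeriv, (castAdd_ne_zIdx (n := n) j).symm,
        (castAdd_ne_yIdx (n := n) j).symm]
  · fin_cases b <;> fin_cases b'
    · simp [jacobian, termPDeriv, liftTerm₂,
        realize_termPDeriv_relabel_of_not_mem_range _ zIdx_not_mem_range]
    · simp [jacobian, termPDeriv, liftTerm₂, zIdx_ne_yIdx,
        realize_termPDeriv_relabel_of_not_mem_range _ yIdx_not_mem_range]
    · simp [jacobian, termPDeriv, (zIdx_ne_yIdx (n := n)).symm]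
    · simp [jacobian, termPDeriv, zIdx_ne_yIdx]

/-- **The Jacobian determinant is unchanged by an unravelling step.** [folklore] -/
theorem det_jacobian_unravelSys :
    (jacobian (unravelSys t₀ F) a (unravelPt a α t₀)).det = (jacobian F a α).det := by
  have h := congrArg Matrix.det (jacobian_unravelSys_submatrix a α t₀ F)
  rw [Matrix.det_submatrix_equiv_self] at h
  rw [h, det_fromBlocks_unravel]
  congr 1
  ext i j
  simp only [jacobian, Matrix.add_apply, Matrix.of_apply]
  exact (realize_termPDeriv_unravelStep a α t₀ (F i) j).symm

/-- The extended point is a zero of the unravelled system if `ᾱ` is a zero of the original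
one. [folklore] -/
theorem realize_unravelSys_eq_zero (h : ∀ i, (F i).realize (Sum.elim a α) = 0) (r : Fin (n + 2)) :
    (unravelSys t₀ F r).realize (Sum.elim a (unravelPt a α t₀)) = 0 := by
  obtain ⟨x, rfl⟩ := finSumFinEquiv.surjective r
  rcases x with i | b
  · simp [h]
  · fin_cases b
    · simp
    · simp

end Jacobian

/-! ### The measure decreases; existence of an innermost exponential -/

section Measure

variable {κ ι : Type} {n : ℕ}

/-- Renaming unknowns does not change the penalty. [folklore] -/
theorem expPenalty_relabel {ι' : Type} (g : ι → ι') (t : Language.orderedExpRing.Term (κ ⊕ ι)) :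
    expPenalty (t.relabel (Sum.map _root_.id g)) = expPenalty t := by
  rcases t with (c | i) | ⟨f, ts⟩ <;> simp [Term.relabel, expPenalty]

/-- Renaming unknowns does not change `nvCount`. [folklore] -/
theorem nvCount_relabel {ι' : Type} (g : ι → ι') (t : Language.orderedExpRing.Term (κ ⊕ ι)) :
    nvCount (t.relabel (Sum.map _root_.id g)) = nvCount t := by
  induction t with
  | var v => simp [Term.relabel]
  | func f ts ih =>
    cases f with
    | add => simp [Term.relabel, nvCount, ih]
    | mul => simp [Term.relabel, nvCount, ih]
    | neg => simp [Term.relabel, nvCount, ih]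
    | zero => simp [Term.relabel, nvCount]
    | one => simp [Term.relabel, nvCount]
    | exp => simp [Term.relabel, nvCount, ih, expPenalty_relabel]

/-- Lifting does not change `nvCount`. [folklore] -/
@[simp] theorem nvCount_liftTerm₂ (t : Language.orderedExpRing.Term (κ ⊕ Fin n)) :
    nvCount (liftTerm₂ t) = nvCount t :=
  nvCount_relabel _ t

/-- The unravelling step does not increase the penalty. [folklore] -/
theorem expPenalty_unravelStep_le (t₀ s : Language.orderedExpRing.Term (κ ⊕ Fin n)) :
    expPenalty (unravelStep t₀ s) ≤ expPenalty s := by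
  rcases s with (c | i) | ⟨f, ts⟩
  · simp [expPenalty]
  · simp [expPenalty]
  · exact (expPenalty_le_one _).trans (le_of_eq (expPenalty_func f ts).symm)

/-- One unravelling step removes at least as many exponentials of non-unknowns as there are
occurrences of `exp(t₀)` (for `t₀` not an unknown). [folklore] -/
theorem nvCount_unravelStep_add_occ_le {t₀ : Language.orderedExpRing.Term (κ ⊕ Fin n)}
    (ht₀ : expPenalty t₀ = 1) (s : Language.orderedExpRing.Term (κ ⊕ Fin n)) :
    nvCount (unravelStep t₀ s) + occ t₀ s ≤ nvCount s := by
  induction s with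
  | var v => rcases v with c | i <;> simp
  | func f ts ih =>
    cases f with
    | add =>
      have h0 := ih 0; have h1 := ih 1
      simp only [unravelStep, nvCount, occ, nvCount_add] at h0 h1 ⊢
      omega
    | mul =>
      have h0 := ih 0; have h1 := ih 1
      simp only [unravelStep, nvCount, occ, nvCount_mul] at h0 h1 ⊢
      omega
    | neg =>
      have h0 := ih 0
      simp only [unravelStep, nvCount, occ, nvCount_neg] at h0 ⊢
      omega
    | zero => simp [unravelStep, nvCount, occ]
    | one => simp [unravelStep, nvCount, occ]
    | exp =>
      by_cases h : func expRingFunc.exp ts = Language.orderedExpRing.termExp t₀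
      · have e1 : nvCount (func expRingFunc.exp ts) = expPenalty t₀ + nvCount t₀ := by
          rw [h]; rfl
        rw [e1]
        simp only [unravelStep, occ, h, if_true, nvCount_var]
        omega
      · have h0 := ih 0
        have hp := expPenalty_unravelStep_le t₀ (ts 0)
        simp only [unravelStep, nvCount, occ, h, if_false, nvCount_termExp] at h0 ⊢
        omega

/-- A term with an exponential of a non-unknown has an *innermost* one: a subterm `exp(t₀)`
with `t₀` not an unknown and without exponentials of non-unknowns inside. [folklore] -/
theorem exists_innermost (s : Language.orderedExpRing.Term (κ ⊕ Fin n)) (hs : 0 < nvCount s) :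
    ∃ t₀ : Language.orderedExpRing.Term (κ ⊕ Fin n),
      expPenalty t₀ = 1 ∧ nvCount t₀ = 0 ∧ 0 < occ t₀ s := by
  induction s with
  | var v => simp at hs
  | func f ts ih =>
    cases f with
    | add =>
      simp only [nvCount] at hs
      by_cases h0 : 0 < nvCount (ts 0)
      · obtain ⟨t₀, h1, h2, h3⟩ := ih 0 h0
        exact ⟨t₀, h1, h2, by simp only [occ]; omega⟩
      · obtain ⟨t₀, h1, h2, h3⟩ := ih 1 (by omega)
        exact ⟨t₀, h1, h2, by simp only [occ]; omega⟩
    | mul =>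
      simp only [nvCount] at hs
      by_cases h0 : 0 < nvCount (ts 0)
      · obtain ⟨t₀, h1, h2, h3⟩ := ih 0 h0
        exact ⟨t₀, h1, h2, by simp only [occ]; omega⟩
      · obtain ⟨t₀, h1, h2, h3⟩ := ih 1 (by omega)
        exact ⟨t₀, h1, h2, by simp only [occ]; omega⟩
    | neg =>
      simp only [nvCount] at hs
      obtain ⟨t₀, h1, h2, h3⟩ := ih 0 hs
      exact ⟨t₀, h1, h2, by simp only [occ]; omega⟩
    | zero => simp [nvCount] at hs
    | one => simp [nvCount] at hs
    | exp =>
      simp only [nvCount] at hs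
      by_cases h0 : 0 < nvCount (ts 0)
      · obtain ⟨t₀, h1, h2, h3⟩ := ih 0 h0
        refine ⟨t₀, h1, h2, ?_⟩
        simp only [occ]
        split_ifs
        · exact Nat.one_pos
        · exact h3
      · have hc : nvCount (ts 0) = 0 := by omega
        have hpen : expPenalty (ts 0) = 1 := by
          have := expPenalty_le_one (ts 0); omega
        have hts : func expRingFunc.exp ts = Language.orderedExpRing.termExp (ts 0) := by
          change func _ _ = func _ _
          congr 1
          funext l
          fin_cases l
          rfl
        refine ⟨ts 0, hpen, hc, ?_⟩
        simp only [occ, hts, if_true, Nat.one_pos]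

end Measure

/-! ### Flat terms are exponential polynomials -/

section Flat

variable {κ : Type} {n : ℕ}

/-- The polynomial variable `Yᵢ` for the argument `xᵢ` of a flat exponential `exp(xᵢ)` (junk `0`
otherwise). [folklore] -/
def expArgPoly : Language.orderedExpRing.Term (κ ⊕ Fin n) →
    Language.orderedRing.Term (κ ⊕ (Fin n ⊕ Fin n))
  | var (Sum.inr i) => var (Sum.inr (Sum.inr i))
  | _ => 0

/-- The polynomial `p(ā; X̄, Ȳ)` of a flat exponential term (every `exp` applied to an unknown
`xᵢ`, replaced by `Yᵢ`). [folklore] -/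
def toPoly : Language.orderedExpRing.Term (κ ⊕ Fin n) →
    Language.orderedRing.Term (κ ⊕ (Fin n ⊕ Fin n))
  | var (Sum.inl c) => var (Sum.inl c)
  | var (Sum.inr i) => var (Sum.inr (Sum.inl i))
  | func expRingFunc.add ts => (fun l => toPoly (ts l)) 0 + (fun l => toPoly (ts l)) 1
  | func expRingFunc.mul ts => (fun l => toPoly (ts l)) 0 * (fun l => toPoly (ts l)) 1
  | func expRingFunc.neg ts => -(fun l => toPoly (ts l)) 0
  | func expRingFunc.zero _ => 0
  | func expRingFunc.one _ => 1
  | func expRingFunc.exp ts => expArgPoly (ts 0)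

/-- `expPolyTerm` commutes with `+` (syntactically). [folklore] -/
theorem expPolyTerm_add (p q : Language.orderedRing.Term (κ ⊕ (Fin n ⊕ Fin n))) :
    expPolyTerm (p + q) = expPolyTerm p + expPolyTerm q := by
  change func _ _ = func _ _
  congr 1
  funext l
  fin_cases l <;> rfl

/-- `expPolyTerm` commutes with `*` (syntactically). [folklore] -/
theorem expPolyTerm_mul (p q : Language.orderedRing.Term (κ ⊕ (Fin n ⊕ Fin n))) :
    expPolyTerm (p * q) = expPolyTerm p * expPolyTerm q := by
  change func _ _ = func _ _
  congr 1
  funext l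
  fin_cases l <;> rfl

/-- `expPolyTerm` commutes with `-` (syntactically). [folklore] -/
theorem expPolyTerm_neg (p : Language.orderedRing.Term (κ ⊕ (Fin n ⊕ Fin n))) :
    expPolyTerm (-p) = -expPolyTerm p := by
  change func _ _ = func _ _
  congr 1
  funext l
  fin_cases l; rfl

/-- `expPolyTerm 0 = 0` (syntactically). [folklore] -/
theorem expPolyTerm_zero :
    expPolyTerm (0 : Language.orderedRing.Term (κ ⊕ (Fin n ⊕ Fin n))) = 0 := by
  change func _ _ = func _ _
  congr 1
  funext l
  exact l.elim0

/-- `expPolyTerm 1 = 1` (syntactically). [folklore] -/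
theorem expPolyTerm_one :
    expPolyTerm (1 : Language.orderedRing.Term (κ ⊕ (Fin n ⊕ Fin n))) = 1 := by
  change func _ _ = func _ _
  congr 1
  funext l
  exact l.elim0

/-- **A flat term is an exponential polynomial**, syntactically: `p(ā; x̄, e^{x̄}) = s` for
`p = toPoly s`. [folklore] -/
theorem expPolyTerm_toPoly (s : Language.orderedExpRing.Term (κ ⊕ Fin n)) (hs : nvCount s = 0) :
    expPolyTerm (toPoly s) = s := by
  induction s with
  | var v => rcases v with c | i <;> rfl
  | func f ts ih =>
    cases f with
    | add =>
      simp only [nvCount, Nat.add_eq_zero_iff] at hs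
      rw [show toPoly (func expRingFunc.add ts) = toPoly (ts 0) + toPoly (ts 1) from rfl,
        expPolyTerm_add, ih 0 hs.1, ih 1 hs.2]
      change func _ _ = func _ _
      congr 1
      funext l
      fin_cases l <;> rfl
    | mul =>
      simp only [nvCount, Nat.add_eq_zero_iff] at hs
      rw [show toPoly (func expRingFunc.mul ts) = toPoly (ts 0) * toPoly (ts 1) from rfl,
        expPolyTerm_mul, ih 0 hs.1, ih 1 hs.2]
      change func _ _ = func _ _
      congr 1
      funext l
      fin_cases l <;> rfl
    | neg =>
      simp only [nvCount] at hs
      rw [show toPoly (func expRingFunc.neg ts) = -toPoly (ts 0) from rfl, expPolyTerm_neg, ih 0 hs]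
      change func _ _ = func _ _
      congr 1
      funext l
      fin_cases l; rfl
    | zero =>
      rw [show toPoly (func expRingFunc.zero ts) = 0 from rfl, expPolyTerm_zero]
      change func _ _ = func _ _
      congr 1
      funext l
      exact l.elim0
    | one =>
      rw [show toPoly (func expRingFunc.one ts) = 1 from rfl, expPolyTerm_one]
      change func _ _ = func _ _
      congr 1
      funext l
      exact l.elim0
    | exp =>
      simp only [nvCount, Nat.add_eq_zero_iff] at hs
      rw [show toPoly (func expRingFunc.exp ts) = expArgPoly (ts 0) from rfl]
      generalize hts : ts 0 = u at hs
      rcases u with (c | i) | ⟨g, us⟩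
      · simp [expPenalty] at hs
      · change Language.orderedExpRing.termExp (var (Sum.inr i)) = func expRingFunc.exp ts
        change func _ _ = func _ _
        congr 1
        funext l
        fin_cases l
        exact hts.symm
      · simp [expPenalty] at hs

end Flat

/-! ### The induction and the discharge of `Wilkie1996_unravelling` -/

section Main

variable {k K : Language.Theory.ModelType.{0, 0, 0} realExpTheory}

/-- The number of exponentials of non-unknowns in the unravelled system is smaller. [folklore] -/
theorem sum_nvCount_unravelSys_lt {n : ℕ} (F : Fin n → Language.orderedExpRing.Term (k ⊕ Fin n))
    {t₀ : Language.orderedExpRing.Term (k ⊕ Fin n)} (ht₀ : expPenalty t₀ = 1)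
    (ht₀c : nvCount t₀ = 0) {i₀ : Fin n} (hocc : 0 < occ t₀ (F i₀)) :
    ∑ r, nvCount (unravelSys t₀ F r) < ∑ i, nvCount (F i) := by
  rw [Fin.sum_univ_add]
  simp only [unravelSys_castAdd, Fin.sum_univ_two, natAdd_zero_eq_zIdx, natAdd_one_eq_yIdx,
    unravelSys_zIdx, unravelSys_yIdx, nvCount_add, nvCount_var, nvCount_neg, nvCount_liftTerm₂, ht₀c,
    nvCount_termExp, expPenalty_var_inr, add_zero]
  have hle : ∑ i, nvCount (unravelStep t₀ (F i)) + ∑ i, occ t₀ (F i) ≤ ∑ i, nvCount (F i) := by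
    rw [← Finset.sum_add_distrib]
    exact Finset.sum_le_sum fun i _ => nvCount_unravelStep_add_occ_le ht₀ (F i)
  have hocc' : occ t₀ (F i₀) ≤ ∑ i, occ t₀ (F i) :=
    Finset.single_le_sum (f := fun i => occ t₀ (F i)) (fun i _ => Nat.zero_le _) (Finset.mem_univ i₀)
  omega

/-- **Unravelling, the induction** (on the number of exponentials applied to non-unknowns): an
exponential-algebraic point extends to a non-singular zero of a square exponential-polynomial
system in more unknowns. [folklore] -/
theorem exists_isExpPolynomialPointOver_extension (f : k ↪[Language.orderedExpRing] K) (N : ℕ) :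
    ∀ (n : ℕ) (F : Fin n → Language.orderedExpRing.Term (k ⊕ Fin n)) (α : Fin n → K),
      ∑ i, nvCount (F i) = N → (∀ i, (F i).realize (Sum.elim f α) = 0) →
        (jacobian F f α).det ≠ 0 →
          ∃ (m : ℕ) (α' : Fin m → K) (h : n ≤ m),
            IsExpPolynomialPointOver f α' ∧ ∀ i, α' (Fin.castLE h i) = α i := by
  induction N using Nat.strong_induction_on with
  | _ N ih =>
    intro n F α hN h0 hJ
    rcases Nat.eq_zero_or_pos N with rfl | hpos
    · -- all terms are flat: they are exponential polynomials
      have hflat : ∀ i, nvCount (F i) = 0 := fun i =>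
        (Finset.sum_eq_zero_iff.1 hN) i (Finset.mem_univ i)
      have hF : (fun i => expPolyTerm (toPoly (F i))) = F :=
        funext fun i => expPolyTerm_toPoly (F i) (hflat i)
      refine ⟨n, α, le_rfl, ⟨fun i => toPoly (F i), ?_, ?_⟩, fun i => congrArg α (Fin.ext rfl)⟩
      · intro i
        rw [expPolyTerm_toPoly (F i) (hflat i)]
        exact h0 i
      · rw [hF]
        exact hJ
    · -- unravel an innermost exponential of a non-unknown
      have hex : ∃ i₀, 0 < nvCount (F i₀) := by
        by_contra hne
        push Not at hne
        have : ∑ i, nvCount (F i) = 0 := Finset.sum_eq_zero fun i _ => Nat.le_zero.1 (hne i)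
        omega
      obtain ⟨i₀, hi₀⟩ := hex
      obtain ⟨t₀, ht₀, ht₀c, hocc⟩ := exists_innermost (F i₀) hi₀
      have hlt : ∑ r, nvCount (unravelSys t₀ F r) < N := hN ▸ sum_nvCount_unravelSys_lt F ht₀ ht₀c hocc
      obtain ⟨m, α', h', hP, hagree⟩ := ih _ hlt (n + 2) (unravelSys t₀ F) (unravelPt f α t₀) rfl
        (realize_unravelSys_eq_zero f α t₀ F h0)
        (by rw [det_jacobian_unravelSys]; exact hJ)
      refine ⟨m, α', (Nat.le_add_right n 2).trans h', hP, fun i => ?_⟩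
      have e : Fin.castLE ((Nat.le_add_right n 2).trans h') i = Fin.castLE h' (Fin.castAdd 2 i) :=
        Fin.ext rfl
      rw [e, hagree, unravelPt_castAdd]

end Main

end RealExpModel

/-- **Discharge of the named fact `Wilkie1996_unravelling`** (`Wilkie1996.lean`): every
exponential-algebraic point `ᾱ ∈ Kⁿ` over `k` (Wilkie 1989) extends to a non-singular zero
`(ᾱ, β̄)` of a square exponential-polynomial system over `k` (Wilkie 1996, Definition 2.5 / §9),
with the Jacobian determinant preserved exactly — Wilkie's remarks "composite terms may be
unravelled at the expense of introducing extra existentially quantified variables" (p. 1056) and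
"(This reduction … was already established in [16] (Theorem 2))" (p. 1083).
[cite: WilkieJAMS1996, p. 1056 and p. 1083] -/
theorem Wilkie1996_unravelling_holds : Wilkie1996_unravelling := by
  intro k K f n α ⟨F, h0, hJ⟩
  obtain ⟨m, α', h, hP, hagree⟩ :=
    RealExpModel.exists_isExpPolynomialPointOver_extension f _ n F α rfl h0 hJ
  obtain ⟨d, rfl⟩ := Nat.exists_eq_add_of_le h
  refine ⟨d, fun j => α' (Fin.natAdd n j), ?_⟩
  have e : Fin.append α (fun j => α' (Fin.natAdd n j)) = α' := by
    funext r
    refine Fin.addCases (fun i => ?_) (fun j => ?_) r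
    · rw [Fin.append_left, ← hagree i]
      exact congrArg α' (Fin.ext rfl)
    · rw [Fin.append_right]
  rw [e]
  exact hP

/-- **The two forms of the boundedness statement are equivalent**: for arbitrary exponential
terms (`Wilkie1996_expAlgebraicPoints_bounded`, the hypothesis of Wilkie 1989, Theorem 2, for all
models) and for exponential polynomials as printed in Wilkie 1996, §9, p. 1083
(`Wilkie1996_expPolynomialPoints_bounded`). [folklore] -/
theorem Wilkie1996_expAlgebraicPoints_bounded_iff :
    Wilkie1996_expAlgebraicPoints_bounded ↔ Wilkie1996_expPolynomialPoints_bounded :=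
  ⟨Wilkie1996_expPolynomialPoints_bounded_of_expAlgebraicPoints_bounded,
    Wilkie1996_expAlgebraicPoints_bounded_of_unravelling Wilkie1996_unravelling_holds⟩

/-- **Theorem 7.2 (exponential case) from Wilkie 1989, Theorem 2** — Wilkie's remark "(This
reduction … was already established in [16] (Theorem 2))" (1996, p. 1083), now with the
unravelling proved. [cite: WilkieJAMS1996, §9, p. 1083] -/
theorem Wilkie1996_thm7_2_exp_of_thm2' (h₂ : Wilkie1989_existentiallyClosed_of_bounded) :
    Wilkie1996_thm7_2_exp :=
  Wilkie1996_thm7_2_exp_of_thm2 h₂ Wilkie1996_unravelling_holds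

/-- Theorem 7.2 (exponential case) from the statement of Wilkie 1989, §5 (p. 399) alone, Lemma 3
and Corollary 1 of that paper being proved (`Wilkie1989_thm2_of_mem`,
`Wilkie1989Lemma3Proofs.lean`). [cite: Wilkie1989, §5, p. 399] -/
theorem Wilkie1996_thm7_2_exp_of_mem (hm : Wilkie1989_expAlgebraicPoints_mem) :
    Wilkie1996_thm7_2_exp :=
  Wilkie1996_thm7_2_exp_of_thm2' (Wilkie1989_thm2_of_mem hm)

/-- **Assembly (proved): Wilkie's theorem from its two remaining printed leaves** — the
statement of Wilkie 1989, §5, p. 399 (`Wilkie1989_expAlgebraicPoints_mem`: for models `k ⊆ K` of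
`T_exp` in which all e.a. points over `k` are bounded over `k`, all e.a. points over `k` lie in
`kⁿ`; proved in §§5–6 there) and the statement established in Wilkie 1996, §§9–11
(`Wilkie1996_expPolynomialPoints_bounded`, p. 1083) — via Lemma 3 and Corollary 1 of Wilkie 1989
(proved), the unravelling (proved here), Theorem 7.2 and Robinson's test (proved). [cite: WilkieJAMS1996, §9, p. 1083] -/
theorem wilkie_isModelComplete_of_mem_of_expPolynomialPoints_bounded
    (hm : Wilkie1989_expAlgebraicPoints_mem) (hb : Wilkie1996_expPolynomialPoints_bounded) :
    wilkie_isModelComplete :=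
  wilkie_isModelComplete_of_thm7_2_exp (Wilkie1996_thm7_2_exp_of_mem hm) hb

end Literature.ModelTheory.ExponentialFields
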